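import Summits.KontsevichZagierPeriods.KontsevichZagierPeriods.Theorems.SoloInformedAlgToricRational
import Summits.KontsevichZagierPeriods.KontsevichZagierPeriods.Theorems.SoloInformedToricDenCalculus
import HarnessLib

/-!
# The DEN-calculus over a field of real algebraic numbers: rules ND and VERTEX

Solo programme `solo-KontsevichZagierPeriods-informed`, session s107: the re-base of the
DEN-calculus of the cube crux (`SoloInformedToricDenCalculus`) on a coefficient field `K` of real
algebraic numbers (`hK : ∀ c, IsAlgebraic ℚ (algebraMap K ℝ c)`), step 6.

A polynomial `Q ∈ K[x₁, …, xₙ]` is a **presentable denominator** (`SoloInformedPresentableDenK Q`)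
if for EVERY numerator `P ∈ K[x]` and every `IntegralRep` `r = [σ, f]` with
`(0,1)ⁿ ⊆ σ ⊆ [0,1]ⁿ` and `f = P/Q` on the open cube, `of r` is presentable.  As over `ℚ` the
property depends only on `Q` on the open cube and may be tested on the open cube.  This file
provides:

* `soloInformed_presentable_of_monoChartK` — rule (2) along a monomial chart `μ_A`
  (`det A ≠ 0`) for a chart piece whose pulled-back form is `P'/Q'`, `P', Q' ∈ K[v]`;
* `soloInformedVertexReflectK S` — the vertex reflection `x_j ↦ 1 − x_j (j ∈ S)` on `K[x]`;
* **RULE ND** `soloInformed_presentableDenK_of_nondegenerate` (THEOREM ND-GEN over `K`);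
* **RULE VERTEX** `soloInformed_presentableDenK_of_vertexReflect` and THEOREM VERTEX
  `soloInformed_presentableDenK_of_vertexReflect_nondegenerate`.

RULE DIAG, the box-split rule and the dominant-vertex lemma over `K` follow in the next files.

References: M. Kontsevich, D. Zagier, *Periods* (2001) §1.2 rules (1)–(2); A. N. Varchenko,
Funct. Anal. Appl. 10 (1976); W. Fulton, *Introduction to Toric Varieties* (1993) §2.6.
-/

noncomputable section

open scoped BigOperators
open MeasureTheory Set
open Literature.NumberTheory.Transcendental Literature.NumberTheory.Transcendental.KZ
open Literature.ModelTheory.ExponentialFields (IsSemialgebraic)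
open Literature.AlgebraicGeometry.Resolution

namespace Summit.KontsevichZagierPeriods.KontsevichZagierPeriods.Theorems

variable {n : ℕ} {K : Type*} [Field K] [Algebra K ℝ]

/-! ## Rule (2) along a monomial chart, `K`-rational pulled-back forms -/

/-- **Rule (2) along a monomial chart**, `K`-coefficients.  Let `R` be an `IntegralRep` on the
chart image `μ_A((0,1)ⁿ)` (`det A ≠ 0`) whose pulled-back form `R.integrand(μ_A v) · |det Dμ_A(v)|`
equals `P'(v)/Q'(v)` on the open cube, `Q' ≠ 0` there.  If every `IntegralRep` on `(0,1)ⁿ` with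
integrand `P'/Q'` is presentable, so is `of R`. [this work; Kontsevich–Zagier 2001 §1.2 rule (2)] -/
theorem soloInformed_presentable_of_monoChartK
    (hK : ∀ c : K, IsAlgebraic ℚ (algebraMap K ℝ c)) (A : Matrix (Fin n) (Fin n) ℕ)
    (hA : (A.map (fun t : ℕ => (t : ℝ))).det ≠ 0) (P' Q' : MvPolynomial (Fin n) K)
    (hQ' : ∀ v ∈ soloInformedOpenCube n, (MvPolynomial.aeval v Q' : ℝ) ≠ 0) (R : IntegralRep n)
    (hdom : R.domain =
      (fun (v : Fin n → ℝ) (i : Fin n) => ∏ j, v j ^ A i j) '' soloInformedOpenCube n)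
    (hRi : ∀ v ∈ soloInformedOpenCube n,
      R.integrand (fun i => ∏ j, v j ^ A i j) * |(soloInformedMonoD A v).det| =
        (MvPolynomial.aeval v P' : ℝ) / MvPolynomial.aeval v Q')
    (hpres : ∀ ρ : IntegralRep n, ρ.domain = soloInformedOpenCube n →
      EqOn ρ.integrand (fun v => (MvPolynomial.aeval v P' : ℝ) / MvPolynomial.aeval v Q')
        (soloInformedOpenCube n) → of ρ ∈ soloInformedPresentable) :
    of R ∈ soloInformedPresentable := by
  have hO := soloInformedOpenCube_eq_pi n
  have hmeasO : MeasurableSet (soloInformedOpenCube n) := by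
    rw [hO]; exact MeasurableSet.univ_pi fun _ => measurableSet_Ioo
  have hderiv : ∀ x ∈ soloInformedOpenCube n, HasFDerivWithinAt
      (fun (v : Fin n → ℝ) (i : Fin n) => ∏ j, v j ^ A i j) (soloInformedMonoD A x)
      (soloInformedOpenCube n) x :=
    fun x _ => soloInformed_hasFDerivWithinAt_monomialMap A _ x
  have hinj : InjOn (fun (v : Fin n → ℝ) (i : Fin n) => ∏ j, v j ^ A i j)
      (soloInformedOpenCube n) := by
    rw [hO]; exact injOn_monomialMap_pi_Ioo hA
  have hint1 : IntegrableOn (fun v => |(soloInformedMonoD A v).det| •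
      R.integrand (fun i => ∏ j, v j ^ A i j)) (soloInformedOpenCube n) := by
    have h := R.integrableOn
    rw [hdom, integrableOn_image_iff_integrableOn_abs_det_fderiv_smul volume hmeasO hderiv hinj]
      at h
    exact h
  have hint' : IntegrableOn (fun v => (MvPolynomial.aeval v P' : ℝ) / MvPolynomial.aeval v Q')
      (soloInformedOpenCube n) :=
    hint1.congr_fun (fun v hv => by
      show |(soloInformedMonoD A v).det| • R.integrand _ = _
      rw [smul_eq_mul, mul_comm]; exact hRi v hv) hmeasO
  set ρt := soloInformedOfRationalK hK (soloInformedOpenCube n) P' Q'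
    (isSemialgebraic_soloInformedOpenCube n) hQ' hint' with hρt
  have h2 : of ρt - of R ∈ relations := by
    refine changeOfVariablesRel_subset_relations ⟨n, ρt, R,
      fun (v : Fin n → ℝ) (i : Fin n) => ∏ j, v j ^ A i j, soloInformedMonoD A,
      isSemialgebraicMapOn_monomialMap A (isSemialgebraic_soloInformedOpenCube n), hderiv, hinj,
      ?_, fun v hv => ?_, rfl⟩
    · show R.domain = _ '' soloInformedOpenCube n
      exact hdom
    · have hv' : v ∈ soloInformedOpenCube n := hv
      show (MvPolynomial.aeval v P' : ℝ) / MvPolynomial.aeval v Q' = _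
      exact (hRi v hv').symm
  have hp := hpres ρt rfl fun v _ => rfl
  rw [← neg_sub] at h2
  exact soloInformed_presentable_of_sub_mem (by simpa using relations.neg_mem h2) hp

/-- `P(μ_A v) = P_A(v)` for the chart quotient with `m = 0`. [this work] -/
theorem soloInformed_aeval_monomialMap_chartQuotK_zero (A : Matrix (Fin n) (Fin n) ℕ)
    (P : MvPolynomial (Fin n) K) (v : Fin n → ℝ) :
    (MvPolynomial.aeval (fun i => ∏ j, v j ^ A i j) P : ℝ) =
      MvPolynomial.aeval v (soloInformedChartQuotK A P 0) := by
  rw [soloInformed_aevalK_monomialMap_eq A P 0 (fun _ _ _ => Nat.zero_le _) v]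
  simp

/-! ## Vertex reflections on `K[x]` -/

/-- The **vertex reflection** `x_j ↦ 1 − x_j (j ∈ S)`, `x_j ↦ x_j (j ∉ S)` on `K[x₁, …, xₙ]`.
[this work] -/
def soloInformedVertexReflectK (S : Finset (Fin n)) :
    MvPolynomial (Fin n) K →ₐ[K] MvPolynomial (Fin n) K :=
  MvPolynomial.bind₁ fun j => if j ∈ S then 1 - MvPolynomial.X j else MvPolynomial.X j

omit [Algebra K ℝ] in
/-- Vertex reflection of a variable. -/
theorem soloInformed_vertexReflectK_X (S : Finset (Fin n)) (j : Fin n) :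
    soloInformedVertexReflectK S (MvPolynomial.X j : MvPolynomial (Fin n) K) =
      if j ∈ S then 1 - MvPolynomial.X j else MvPolynomial.X j := by
  unfold soloInformedVertexReflectK
  rw [MvPolynomial.bind₁_X_right]

/-- Evaluating the vertex-reflected polynomial is evaluating at the vertex-moved point.
[this work] -/
theorem soloInformed_aeval_vertexReflectK (S : Finset (Fin n)) (x : Fin n → ℝ)
    (P : MvPolynomial (Fin n) K) :
    (MvPolynomial.aeval x (soloInformedVertexReflectK S P) : ℝ) =
      MvPolynomial.aeval (soloInformedVertexMove S x) P := by
  unfold soloInformedVertexReflectK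
  rw [MvPolynomial.aeval_bind₁]
  have h : (fun i => (MvPolynomial.aeval x
      (if i ∈ S then 1 - MvPolynomial.X i else MvPolynomial.X i : MvPolynomial (Fin n) K) : ℝ)) =
      soloInformedVertexMove S x := by
    funext j
    by_cases hj : j ∈ S <;> simp [soloInformedVertexMove, hj]
  rw [h]

/-- Non-vanishing on the open cube from cube-nondegeneracy of a vertex reflection. [this work] -/
theorem soloInformed_aevalK_ne_zero_of_vertexReflect_nondegenerate (S : Finset (Fin n))
    {Q : MvPolynomial (Fin n) K}
    (hND : SoloInformedCubeNondegenerateK (soloInformedVertexReflectK S Q)) {v : Fin n → ℝ}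
    (hv : v ∈ soloInformedOpenCube n) : (MvPolynomial.aeval v Q : ℝ) ≠ 0 := by
  have h := soloInformed_aevalK_ne_zero_of_nondegenerate hND (x := soloInformedVertexMove S v)
    fun i => ⟨(soloInformed_vertexMove_mem S hv i).1, (soloInformed_vertexMove_mem S hv i).2.le⟩
  rwa [soloInformed_aeval_vertexReflectK, soloInformed_vertexMove_vertexMove] at h

/-! ## Presentable denominators over `K` -/

/-- `Q ∈ K[x]` is a **presentable denominator**: every `[σ, P/Q]` with `(0,1)ⁿ ⊆ σ ⊆ [0,1]ⁿ` is
presentable, for every numerator `P ∈ K[x]`. [this work] -/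
def SoloInformedPresentableDenK (Q : MvPolynomial (Fin n) K) : Prop :=
  ∀ (P : MvPolynomial (Fin n) K) (r : IntegralRep n), soloInformedOpenCube n ⊆ r.domain →
    r.domain ⊆ soloInformedCube n →
    EqOn r.integrand (fun x => (MvPolynomial.aeval x P : ℝ) / MvPolynomial.aeval x Q)
      (soloInformedOpenCube n) →
    of r ∈ soloInformedPresentable

/-- **The open cube suffices**: `∂[0,1]ⁿ` is null (rule (1a)). [this work] -/
theorem soloInformed_presentableDenK_of_open (Q : MvPolynomial (Fin n) K)
    (h : ∀ (P : MvPolynomial (Fin n) K) (ρ : IntegralRep n), ρ.domain = soloInformedOpenCube n →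
      EqOn ρ.integrand (fun x => (MvPolynomial.aeval x P : ℝ) / MvPolynomial.aeval x Q)
        (soloInformedOpenCube n) → of ρ ∈ soloInformedPresentable) :
    SoloInformedPresentableDenK Q := by
  intro P r hO hC hri
  set r₀ := r.restrict (soloInformedOpenCube n) (isSemialgebraic_soloInformedOpenCube n) hO
    with hr₀
  have h₀ : of r - of r₀ ∈ relations :=
    r.of_sub_of_restrict_mem_relations (isSemialgebraic_soloInformedOpenCube n) hO
      (measure_mono_null
        (show r.domain \ soloInformedOpenCube n ⊆ soloInformedCube n \ soloInformedOpenCube n from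
          fun _ hx => ⟨hC hx.1, hx.2⟩)
        (soloInformed_volume_cube_diff_openCube n))
  exact soloInformed_presentable_of_sub_mem h₀ (h P r₀ rfl fun x hx => hri hx)

/-- A presentable denominator depends only on its values on the open cube. [this work] -/
theorem soloInformed_presentableDenK_congr {Q Q' : MvPolynomial (Fin n) K}
    (hQQ' : ∀ x ∈ soloInformedOpenCube n,
      (MvPolynomial.aeval x Q : ℝ) = MvPolynomial.aeval x Q')
    (h : SoloInformedPresentableDenK Q) : SoloInformedPresentableDenK Q' :=
  fun P r hO hC hri => h P r hO hC fun x hx => (hri hx).trans (by simp only [hQQ' x hx])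

/-- A presentable denominator in the output format of the cube crux
`SoloInformedAyoubCubeResolutionCube` (`k = 1`). [this work] -/
theorem soloInformed_cubeResolution_of_presentableDenK {Q : MvPolynomial (Fin n) K}
    (hQ : SoloInformedPresentableDenK Q) (P : MvPolynomial (Fin n) K) (r : IntegralRep n)
    (hr : r.domain = soloInformedCube n)
    (hri : EqOn r.integrand (fun x => (MvPolynomial.aeval x P : ℝ) / MvPolynomial.aeval x Q)
      (soloInformedOpenCube n)) :
    ∃ (k : ℕ) (_ : k ≠ 0) (m' : ℕ) (d : Fin m' → ℕ) (G : ∀ j, SoloInformedCubeGerm (d j))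
      (c : Fin m' → ℤ) (ρ : ∀ j, IntegralRep (d j)),
      (∀ j, (ρ j).domain = soloInformedCube (d j)) ∧
      (∀ j, EqOn (ρ j).integrand (fun x => ((G j).g (soloInformedToC (d j) x)).re)
        (soloInformedCube (d j))) ∧
      k • of r - ∑ j, c j • of (ρ j) ∈ relations :=
  soloInformed_exists_fin_of_presentable
    (hQ P r (hr ▸ soloInformedOpenCube_subset_cube n) hr.le hri)

/-! ## RULE ND and RULE VERTEX over `K` -/

/-- **RULE ND over `K`.**  A cube-nondegenerate polynomial `Q ∈ K[x]` is a presentable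
denominator (THEOREM ND-GEN over `K`). [this work] -/
theorem soloInformed_presentableDenK_of_nondegenerate
    (hK : ∀ c : K, IsAlgebraic ℚ (algebraMap K ℝ c)) {Q : MvPolynomial (Fin n) K}
    (hND : SoloInformedCubeNondegenerateK Q) : SoloInformedPresentableDenK Q :=
  soloInformed_presentableDenK_of_open Q fun P ρ hρ hρi =>
    soloInformed_presentable_of_nondegenerateK_rational_open hK P Q hND ρ hρ hρi

/-- **RULE VERTEX over `K`.**  If `Q` has no zero on the open cube and some vertex reflection
`vertexReflectK S Q` is a presentable denominator, then `Q` is a presentable denominator: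
rule (2) along the vertex move `Φ_S` (`|det Φ_S'| = 1`). [this work] -/
theorem soloInformed_presentableDenK_of_vertexReflect
    (hK : ∀ c : K, IsAlgebraic ℚ (algebraMap K ℝ c)) (S : Finset (Fin n))
    {Q : MvPolynomial (Fin n) K}
    (hQ : ∀ x ∈ soloInformedOpenCube n, (MvPolynomial.aeval x Q : ℝ) ≠ 0)
    (h : SoloInformedPresentableDenK (soloInformedVertexReflectK S Q)) :
    SoloInformedPresentableDenK Q := by
  refine soloInformed_presentableDenK_of_open Q fun P ρ hρ hρi => ?_
  have hQt : ∀ x ∈ soloInformedOpenCube n,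
      (MvPolynomial.aeval x (soloInformedVertexReflectK S Q) : ℝ) ≠ 0 := fun x hx => by
    rw [soloInformed_aeval_vertexReflectK]
    exact hQ _ (soloInformed_vertexMove_mem S hx)
  have hint : IntegrableOn (fun x => (MvPolynomial.aeval x P : ℝ) / MvPolynomial.aeval x Q)
      (soloInformedOpenCube n) := by
    have h := ρ.integrableOn.congr_fun (fun x hx => hρi (by rwa [hρ] at hx))
      ρ.measurableSet_domain_holds
    rwa [hρ] at h
  have hint' : IntegrableOn (fun x => (MvPolynomial.aeval x (soloInformedVertexReflectK S P) : ℝ) /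
      MvPolynomial.aeval x (soloInformedVertexReflectK S Q)) (soloInformedOpenCube n) := by
    have hmeas : MeasurableSet (soloInformedOpenCube n) := hρ ▸ ρ.measurableSet_domain_holds
    have h := (integrableOn_image_iff_integrableOn_abs_det_fderiv_smul volume hmeas
      (fun x _ => (soloInformed_hasFDerivAt_vertexMove S x).hasFDerivWithinAt)
      (soloInformed_vertexMove_injective S).injOn
      (fun x => (MvPolynomial.aeval x P : ℝ) / MvPolynomial.aeval x Q)).1
      (by rw [soloInformed_image_vertexMove]; exact hint)
    refine h.congr_fun (fun x _ => ?_) hmeas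
    simp only [soloInformed_abs_det_vertexDeriv, one_smul, soloInformed_aeval_vertexReflectK]
  -- rule (2) along the vertex move
  set ρt := soloInformedOfRationalK hK (soloInformedOpenCube n) (soloInformedVertexReflectK S P)
      (soloInformedVertexReflectK S Q) (isSemialgebraic_soloInformedOpenCube n) hQt hint'
    with hρt
  have h2 : of ρt - of ρ ∈ relations := by
    refine changeOfVariablesRel_subset_relations ⟨n, ρt, ρ, soloInformedVertexMove S,
      fun _ => soloInformedVertexDeriv S,
      soloInformed_isSemialgebraicMapOn_vertexMove S (isSemialgebraic_soloInformedOpenCube n),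
      fun x _ => (soloInformed_hasFDerivAt_vertexMove S x).hasFDerivWithinAt,
      (soloInformed_vertexMove_injective S).injOn, ?_, fun x hx => ?_, rfl⟩
    · show ρ.domain = soloInformedVertexMove S '' soloInformedOpenCube n
      rw [soloInformed_image_vertexMove, hρ]
    · have hx' : x ∈ soloInformedOpenCube n := hx
      show (MvPolynomial.aeval x (soloInformedVertexReflectK S P) : ℝ) /
          MvPolynomial.aeval x (soloInformedVertexReflectK S Q) = _
      rw [hρi (soloInformed_vertexMove_mem S hx'), soloInformed_abs_det_vertexDeriv, mul_one,
        soloInformed_aeval_vertexReflectK, soloInformed_aeval_vertexReflectK]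
  have hpres : of ρt ∈ soloInformedPresentable :=
    h (soloInformedVertexReflectK S P) ρt subset_rfl (soloInformedOpenCube_subset_cube n)
      fun _ _ => rfl
  rw [← neg_sub] at h2
  exact soloInformed_presentable_of_sub_mem (by simpa using relations.neg_mem h2) hpres

/-- RULE VERTEX + RULE ND = **THEOREM VERTEX over `K`**: `Q` is a presentable denominator as soon
as some vertex reflection of `Q` is cube-nondegenerate. [this work] -/
theorem soloInformed_presentableDenK_of_vertexReflect_nondegenerate
    (hK : ∀ c : K, IsAlgebraic ℚ (algebraMap K ℝ c)) (S : Finset (Fin n))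
    {Q : MvPolynomial (Fin n) K}
    (hND : SoloInformedCubeNondegenerateK (soloInformedVertexReflectK S Q)) :
    SoloInformedPresentableDenK Q :=
  soloInformed_presentableDenK_of_vertexReflect hK S
    (fun _ hx => soloInformed_aevalK_ne_zero_of_vertexReflect_nondegenerate S hND hx)
    (soloInformed_presentableDenK_of_nondegenerate hK hND)

end Summit.KontsevichZagierPeriods.KontsevichZagierPeriods.Theorems
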